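import Mathlib
import Summits.PneNP.PneNP.Theorems.PstarGapLemma
import Summits.PneNP.PneNP.Theorems.PstarSAClosure
import Summits.PneNP.PneNP.Theorems.PstarGapPeeling
import Summits.PneNP.PneNP.Theorems.PstarGapSupport
import Summits.PneNP.PneNP.Theorems.PstarMinInfeasibleElim
import Summits.PneNP.PneNP.Theorems.PstarNoDeadCentre
import Summits.PneNP.PneNP.Theorems.PstarChordRepair
import Summits.PneNP.PneNP.Theorems.PstarCentreFree
import Summits.PneNP.PneNP.Theorems.PstarGapOneKills

/-!
# T24.16 from T24.15: free centres ⇒ one AND-typed parity never traps a non-empty minimal infeasible set (ROUND-24)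

FRONTIER range-avoidance ladder (cell `pnp-ideate`, ROUND-24 gap-lemma programme; restricted-model combinatorics — nothing here bears
on `P` versus `NP`).

`gapOneAnd_of_centreFree : PstarNoDeadCentre.CentreFree → PstarNoDeadCentre.GapOneAnd` (memo ROUND-24-PRESEED §13 R10(j), the
corollary chain, audited by the referee seat).  For a pure typed instance with simple overlaps that is `(r, 3/2)`-boundary expanding,
one parity `(C, b)` on AND-type variables and a minimal `{(C,b)}`-infeasible `J ≠ ∅` with `|J| ≤ r`:
(1) no XOR slot of `J` is `J`-private (`PstarChordRepair.no_private_xor`); (2) chords (outputs with both AND slots `J`-private) sit at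
`(1,1)` in every solution and no chord reads an AND slot of a non-chord, so an AND slot of a non-chord that is a boundary variable of
the non-chord family `N` is `J`-private (`and_bdry_transfer`); (3) the LEAF RULE `partner_true_of_leaf_mem_C`: a `J`-private AND slot
inside `C` forces its partner `true` in every solution; (4) COUNTING (`eq_empty_of_centreFree`): `bdry N` consists of XOR tips and
private AND slots, at most one of each kind per output unless an output has two tips (then `PstarGapOneKills.kill_double`), so
`3|N| ≤ 2|bdry N|` yields an output `f ∈ N` with a tip AND a private AND slot `ℓ`; the partner `d` of `ℓ` is a centre of `J`, `ℓ ∉ C`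
by the leaf rule and `CentreFree` (`b := false`), and `CentreFree` (`b := true`) activates `d` — `kill_tip`.  `N = ∅` is
`kill_all_chords`; `W = ∅` is T24.8a (`PstarGapPeeling.eq_empty_of_minInfeasible_empty`).
-/

set_option linter.dupNamespace false -- `Summit.PneNP.PneNP.…`: summit = sub-problem name (D-0017 single-conjunct layout)

open Finset Literature.Computability.Complexity
open Summit.PneNP.PneNP.Theorems.PstarPDT (parity)
open Summit.PneNP.PneNP.Theorems.PstarTyped (Typed)
open Summit.PneNP.PneNP.Theorems.PstarSALevel (varSet bdry BoundaryExpanding SimpleOverlap)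
open Summit.PneNP.PneNP.Theorems.PstarGapLemma (Sat Feasible MinInfeasible)
open Summit.PneNP.PneNP.Theorems.PstarGapPeeling (not_mem_varSet_of_private eval_update_of_not_mem eval_pure
  feasible_of_boundaryExpanding eq_empty_of_minInfeasible_empty)
open Summit.PneNP.PneNP.Theorems.PstarGapSupport (parity_update_of_notMem)
open Summit.PneNP.PneNP.Theorems.PstarGapLinearised (andPair)
open Summit.PneNP.PneNP.Theorems.PstarNoDeadCentre (IsCentre IsAndVar CentreFree GapOneAnd)
open Summit.PneNP.PneNP.Theorems.PstarChordRepair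
open Summit.PneNP.PneNP.Theorems.PstarCentreFree (vars_mem_varSet centreFree)
open Summit.PneNP.PneNP.Theorems.PstarGapOneKills

namespace Summit.PneNP.PneNP.Theorems.PstarGapOneAnd

variable {n m : ℕ}

/-! ## Non-chords: boundary transfer and the leaf rule -/

section Main

variable (I : LocalMap 4 n m) (hI : I.IsPure xorAndPred) (hT : Typed I) {y : Fin m → Bool} {C : Finset (Fin n)} {b : Bool}
  {J : Finset (Fin m)} (hC : ∀ v ∈ C, IsAndVar I v) (hmin : MinInfeasible I y {(C, b)} J)

/-- The non-chord outputs of `J`. -/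
noncomputable def nonChords (J : Finset (Fin m)) : Finset (Fin m) := by
  classical exact J.filter fun j => ¬ IsChord I J j

/-- Membership in `nonChords`. -/
theorem mem_nonChords {J : Finset (Fin m)} {j : Fin m} : j ∈ nonChords I J ↔ j ∈ J ∧ ¬ IsChord I J j := by
  classical
  unfold nonChords
  rw [mem_filter]

/-- An output of `J` outside `nonChords` is a chord. -/
theorem isChord_of_not_mem {J : Finset (Fin m)} {j : Fin m} (hj : j ∈ J) (h : j ∉ nonChords I J) : IsChord I J j := by
  by_contra hc
  exact h ((mem_nonChords I).2 ⟨hj, hc⟩)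

include hT in
/-- **Boundary transfer**: an AND slot of a non-chord that is a boundary variable of the non-chord family is a boundary variable of
`J` (no chord reads it). -/
theorem and_bdry_transfer {f : Fin m} (hf : f ∈ nonChords I J) (s : Fin 4) (hs : 2 ≤ s.val)
    (h : I.vars f s ∈ bdry I (nonChords I J)) : I.vars f s ∈ bdry I J := by
  classical
  have hfJ : f ∈ J := ((mem_nonChords I).1 hf).1
  unfold PstarSALevel.bdry at h ⊢
  rw [mem_filter] at h ⊢
  refine ⟨mem_univ _, ?_⟩
  have heq : (J.filter fun j => I.vars f s ∈ varSet I j) = (nonChords I J).filter fun j => I.vars f s ∈ varSet I j := by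
    ext g
    simp only [mem_filter, mem_nonChords]
    constructor
    · rintro ⟨hg, hv⟩
      refine ⟨⟨hg, fun hch => ?_⟩, hv⟩
      have hne : g ≠ f := fun h' => ((mem_nonChords I).1 hf).2 (h' ▸ hch)
      exact and_slot_not_mem_chord I hT hfJ hg hch hne s hs hv
    · rintro ⟨⟨hg, -⟩, hv⟩
      exact ⟨hg, hv⟩
  rw [heq]
  exact h.2

include hI hmin in
/-- **The leaf rule (F3)**: a `J`-private AND slot inside `C` forces its partner `true` in every solution of `J`. -/
theorem partner_true_of_leaf_mem_C {z : Fin n → Bool} (hz : ∀ j ∈ J, I.eval z j = y j) {f : Fin m} (hf : f ∈ J)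
    {sl sd : Fin 4} (hsl : sl = 2 ∧ sd = 3 ∨ sl = 3 ∧ sd = 2) (hℓb : I.vars f sl ∈ bdry I J) (hℓC : I.vars f sl ∈ C) :
    z (I.vars f sd) = true := by
  by_contra hd
  rw [Bool.not_eq_true] at hd
  set z' := Function.update z (I.vars f sl) (!z (I.vars f sl)) with hz'
  have hsol : ∀ j ∈ J, I.eval z' j = y j := by
    intro j hj
    by_cases hjf : j = f
    · subst hjf
      rw [hz', eval_set_and_false I hI z j hsl hd, hz j hj]
    · rw [hz', eval_update_of_not_mem I j z (not_mem_varSet_of_private I hf hj hjf hℓb (vars_mem_varSet I f sl)), hz j hj]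
  have hpar : parity C z' = !parity C z := by
    rw [hz', parity_update_of_mem hℓC]
    cases parity C z <;> cases z (I.vars f sl) <;> rfl
  by_cases hb : parity C z = b
  · exact no_solution I hmin hz hb
  · refine no_solution I hmin hsol ?_
    rw [hpar]
    revert hb
    cases parity C z <;> cases b <;> simp

/-! ## The assembly -/

include hI hT hC hmin in
/-- **The main lemma**: with free centres, a minimal `{(C,b)}`-infeasible set of at most `r` outputs is empty. -/
theorem eq_empty_of_centreFree (hCF : CentreFree) (hS : SimpleOverlap I) {r : ℕ} (hB : BoundaryExpanding r I) (hJr : J.card ≤ r) :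
    J = ∅ := by
  classical
  by_contra hne
  obtain ⟨z₀, hz₀⟩ := feasible_of_boundaryExpanding I hI hB y J hJr
  set N := nonChords I J with hN
  have hNJ : N ⊆ J := fun j hj => ((mem_nonChords I).1 hj).1
  -- readers of a boundary XOR slot of a non-chord, other than itself, are chords
  have hreaders : ∀ f ∈ N, ∀ s : Fin 4, I.vars f s ∈ bdry I N → ∀ j ∈ J, j ≠ f → I.vars f s ∈ varSet I j → IsChord I J j := by
    intro f hf s hb j hj hjf hv
    by_contra hch
    have hjN : j ∈ N := (mem_nonChords I).2 ⟨hj, hch⟩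
    exact hjf (eq_of_bdry I hb hjN hf hv (vars_mem_varSet I f s))
  -- a non-private XOR slot has another reader
  have hother : ∀ f ∈ J, ∀ s : Fin 4, s.val < 2 → ∃ j ∈ J, j ≠ f ∧ I.vars f s ∈ varSet I j := fun f hf s hs =>
    exists_other_reader I hf (vars_mem_varSet I f s) (no_private_xor I hI hC hmin hf s hs)
  rcases N.eq_empty_or_nonempty with hN0 | hNne
  · -- (a) everything is a chord: flip any XOR slot
    obtain ⟨f, hf⟩ := nonempty_of_ne_empty hne
    exact kill_all_chords I hI hT hC hmin hz₀ hf 0 (by decide) fun j hj _ =>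
      isChord_of_not_mem I hj (by rw [← hN, hN0]; exact notMem_empty j)
  -- (b) an output with two tips
  by_cases htwo : ∃ f ∈ N, I.vars f 0 ∈ bdry I N ∧ I.vars f 1 ∈ bdry I N
  · obtain ⟨f, hfN, h0, h1⟩ := htwo
    have hfJ := hNJ hfN
    refine kill_double I hI hT hC hmin hS hz₀ hfJ (fun j hj hjf hor => ?_) ?_
    · rcases hor with h | h
      · exact hreaders f hfN 0 h0 j hj hjf h
      · exact hreaders f hfN 1 h1 j hj hjf h
    · obtain ⟨j, hj, hjf, hv⟩ := hother f hfJ 0 (by decide)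
      exact ⟨j, hj, hjf, Or.inl hv⟩
  push Not at htwo
  -- (c) counting: a tip on an output owning a private AND slot
  have hexp : 3 * N.card ≤ 2 * (bdry I N).card := hB N ((card_le_card hNJ).trans hJr)
  set NT := N.filter fun f => ∃ s : Fin 4, s.val < 2 ∧ I.vars f s ∈ bdry I N with hNT
  set NL := N.filter fun f => ∃ s : Fin 4, 2 ≤ s.val ∧ I.vars f s ∈ bdry I N with hNL
  set fibT : Fin m → Finset (Fin n) := fun f => (bdry I N).filter fun v => ∃ s : Fin 4, s.val < 2 ∧ I.vars f s = v with hfibT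
  set fibL : Fin m → Finset (Fin n) := fun f => (bdry I N).filter fun v => ∃ s : Fin 4, 2 ≤ s.val ∧ I.vars f s = v with hfibL
  -- every boundary variable of `N` is a slot variable of an output of `N`
  have hslot : ∀ v ∈ bdry I N, ∃ f ∈ N, ∃ s : Fin 4, I.vars f s = v := by
    intro v hv
    have hv' := hv
    unfold PstarSALevel.bdry at hv'
    rw [mem_filter, card_eq_one] at hv'
    obtain ⟨f, hf⟩ := hv'.2
    have hfm : f ∈ N.filter fun j => v ∈ varSet I j := by rw [hf]; exact mem_singleton_self f
    obtain ⟨hfN, hvf⟩ := mem_filter.1 hfm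
    obtain ⟨s, -, hs⟩ := mem_image.1 hvf
    exact ⟨f, hfN, s, hs⟩
  have hcover : bdry I N ⊆ NT.biUnion fibT ∪ NL.biUnion fibL := by
    intro v hv
    obtain ⟨f, hfN, s, hs⟩ := hslot v hv
    rw [mem_union, mem_biUnion, mem_biUnion]
    by_cases hs2 : s.val < 2
    · exact Or.inl ⟨f, mem_filter.2 ⟨hfN, s, hs2, hs ▸ hv⟩, mem_filter.2 ⟨hv, s, hs2, hs⟩⟩
    · push Not at hs2
      exact Or.inr ⟨f, mem_filter.2 ⟨hfN, s, hs2, hs ▸ hv⟩, mem_filter.2 ⟨hv, s, hs2, hs⟩⟩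
  -- fibres have at most one element
  have hfibT1 : ∀ f ∈ NT, (fibT f).card ≤ 1 := by
    intro f hf
    have hfN : f ∈ N := (mem_filter.1 hf).1
    refine card_le_one.2 fun v hv v' hv' => ?_
    obtain ⟨hvb, s, hs, rfl⟩ := mem_filter.1 hv
    obtain ⟨hvb', s', hs', rfl⟩ := mem_filter.1 hv'
    by_contra hvv
    have hss : s ≠ s' := fun h => hvv (by rw [h])
    have h01 : (s = 0 ∧ s' = 1) ∨ (s = 1 ∧ s' = 0) := lt2_pair s s' hs hs' hss
    rcases h01 with ⟨rfl, rfl⟩ | ⟨rfl, rfl⟩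
    · exact htwo f hfN hvb hvb'
    · exact htwo f hfN hvb' hvb
  have hfibL1 : ∀ f ∈ NL, (fibL f).card ≤ 1 := by
    intro f hf
    have hfN : f ∈ N := (mem_filter.1 hf).1
    refine card_le_one.2 fun v hv v' hv' => ?_
    obtain ⟨hvb, s, hs, rfl⟩ := mem_filter.1 hv
    obtain ⟨hvb', s', hs', rfl⟩ := mem_filter.1 hv'
    by_contra hvv
    have hss : s ≠ s' := fun h => hvv (by rw [h])
    have h23 : (s = 2 ∧ s' = 3) ∨ (s = 3 ∧ s' = 2) := ge2_pair s s' hs hs' hss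
    have hchord : IsChord I J f := by
      rcases h23 with ⟨rfl, rfl⟩ | ⟨rfl, rfl⟩
      · exact ⟨and_bdry_transfer I hT hfN 2 (by decide) hvb, and_bdry_transfer I hT hfN 3 (by decide) hvb'⟩
      · exact ⟨and_bdry_transfer I hT hfN 2 (by decide) hvb', and_bdry_transfer I hT hfN 3 (by decide) hvb⟩
    exact ((mem_nonChords I).1 hfN).2 hchord
  have hcardT : (NT.biUnion fibT).card ≤ NT.card :=
    card_biUnion_le.trans (by
      calc ∑ f ∈ NT, (fibT f).card ≤ ∑ _f ∈ NT, 1 := sum_le_sum hfibT1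
        _ = NT.card := by rw [sum_const, smul_eq_mul, mul_one])
  have hcardL : (NL.biUnion fibL).card ≤ NL.card :=
    card_biUnion_le.trans (by
      calc ∑ f ∈ NL, (fibL f).card ≤ ∑ _f ∈ NL, 1 := sum_le_sum hfibL1
        _ = NL.card := by rw [sum_const, smul_eq_mul, mul_one])
  have hbd : (bdry I N).card ≤ NT.card + NL.card :=
    (card_le_card hcover).trans ((card_union_le _ _).trans (Nat.add_le_add hcardT hcardL))
  -- some output is in both `NT` and `NL`
  have hboth : ∃ f ∈ N, (∃ s : Fin 4, s.val < 2 ∧ I.vars f s ∈ bdry I N) ∧ (∃ s : Fin 4, 2 ≤ s.val ∧ I.vars f s ∈ bdry I N) := by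
    by_contra hno
    push Not at hno
    have hdisj : Disjoint NT NL := by
      rw [disjoint_left]
      intro f hfT hfL
      obtain ⟨hfN, s, hs, hb1⟩ := mem_filter.1 hfT
      obtain ⟨-, s', hs', hb2⟩ := mem_filter.1 hfL
      exact hno f hfN ⟨s, hs, hb1⟩ s' hs' hb2
    have hsum : NT.card + NL.card ≤ N.card := by
      rw [← card_union_of_disjoint hdisj]
      exact card_le_card (union_subset (filter_subset _ _) (filter_subset _ _))
    have hNpos : 0 < N.card := card_pos.2 hNne
    omega
  obtain ⟨f, hfN, ⟨s₀, hs₀, ht⟩, ⟨sl, hsl2, hℓ⟩⟩ := hboth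
  have hfJ : f ∈ J := hNJ hfN
  obtain ⟨sd, hpair⟩ : ∃ sd : Fin 4, sl = 2 ∧ sd = 3 ∨ sl = 3 ∧ sd = 2 := by
    have : sl = 2 ∨ sl = 3 := by fin_cases sl <;> simp at hsl2 ⊢
    rcases this with rfl | rfl
    · exact ⟨3, Or.inl ⟨rfl, rfl⟩⟩
    · exact ⟨2, Or.inr ⟨rfl, rfl⟩⟩
  have hsd2 : 2 ≤ sd.val := by rcases hpair with ⟨-, rfl⟩ | ⟨-, rfl⟩ <;> decide
  have hℓJ : I.vars f sl ∈ bdry I J := and_bdry_transfer I hT hfN sl hsl2 hℓ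
  -- the partner is not `J`-private (else `f` would be a chord), hence a centre
  have hdJ : I.vars f sd ∉ bdry I J := by
    intro hdb
    apply ((mem_nonChords I).1 hfN).2
    rcases hpair with ⟨rfl, rfl⟩ | ⟨rfl, rfl⟩
    · exact ⟨hℓJ, hdb⟩
    · exact ⟨hdb, hℓJ⟩
  obtain ⟨g, hg, hgf, hdg⟩ := exists_other_reader I hfJ (vars_mem_varSet I f sd) hdJ
  have hcentre : IsCentre I J (I.vars f sd) := by
    obtain ⟨s', hs', hse⟩ := and_slot_of_mem_varSet I hT hsd2 hdg
    exact ⟨f, hfJ, g, hg, hgf.symm, mem_andPair_of_slot I f sd hsd2, hse ▸ mem_andPair_of_slot I g s' hs'⟩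
  -- the leaf is outside `C` (else the centre would be forced true, against `CentreFree` with `b := false`)
  have hℓC : I.vars f sl ∉ C := by
    intro hℓC
    obtain ⟨z, hz, hzd⟩ := hCF n m r I hI hT hB hS y J hJr _ hcentre false
    have h := partner_true_of_leaf_mem_C I hI hmin hz hfJ hpair hℓJ hℓC
    rw [hzd] at h
    exact Bool.false_ne_true h
  -- activate the centre and flip the tip
  obtain ⟨z, hz, hzd⟩ := hCF n m r I hI hT hB hS y J hJr _ hcentre true
  exact kill_tip I hI hT hC hmin hz hfJ s₀ hs₀ hpair hℓJ hℓC hzd (hreaders f hfN s₀ ht) (hother f hfJ s₀ hs₀)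

end Main

/-! ## T24.16 from T24.15 -/

/-- **T24.16 from T24.15**: free centres imply that one AND-typed parity constraint never makes a non-empty output set minimally
infeasible. -/
theorem gapOneAnd_of_centreFree (hCF : CentreFree) : GapOneAnd := by
  classical
  intro n m r I hI hT hB hS y W J hW hW1 hJr hmin
  rcases Nat.le_one_iff_eq_zero_or_eq_one.1 hW1 with h0 | h1
  · rw [card_eq_zero] at h0
    subst h0
    exact eq_empty_of_minInfeasible_empty I hI hB hmin hJr
  · obtain ⟨cb, rfl⟩ := card_eq_one.1 h1
    obtain ⟨C, b⟩ := cb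
    have hC : ∀ v ∈ C, IsAndVar I v := fun v hv => hW (C, b) (mem_singleton_self _) v hv
    exact eq_empty_of_centreFree I hI hT hC hmin hCF hS hB hJr

/-- **T24.16 — `GapOneAnd` holds** (with `PstarCentreFree.centreFree`, T24.15, landed by the cell's other prover seat): one parity
constraint on AND-type variables never makes a non-empty output set of an expanding typed pure-`P⋆` instance with simple overlaps
minimally infeasible — the AND-typed `|W| ≤ 1` slice of the single-query rung `PstarGapOne` with `K = 0`
(`PstarNoDeadCentre.gapOne_andSlice_of_gapOneAnd`). -/
theorem gapOneAnd : GapOneAnd := gapOneAnd_of_centreFree centreFree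

end Summit.PneNP.PneNP.Theorems.PstarGapOneAnd
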